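import Mathlib
import Literature.MathematicalPhysics.QuantumFieldTheory.Balaban1983to89.B6Expansion282

/-!
# `Balaban1983to89.B6Line4Member12` — p. 237, (2.83) MEMBER 1 ⇒ MEMBER 2 for the off-diagonal operators
R_{□,□′}C_{□′}h_{□′} (□ ≠ □′) of (2.82): the kernel of (□′ − 1)h_□²(Q′G′²Q′*)h_{□′}C_{□′}h_{□′} in the pairing (2.69)
and its bound by the (2.68)-type majorant of Q′G′²Q′*, (2.81), |□′ − 1| ≤ 1, |h_□| ≤ 1, |h_{□′}| ≤ 1 — the step that
`…B6Ineq283` (members 2–5 of (2.83) with their sharp thresholds) lists as NOT proved; composed with that module's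
chain it gives the (2.85)-shaped entry bound of the whole off-diagonal family (B6 = T. Bałaban, *Propagators and
renormalization transformations for lattice gauge theories. II*, Commun. Math. Phys. **96**, 223–250 (1984)
[Balaban1984PropagatorsII]).

CITATION HEADER (lean-in-tree rule 2026-08-18).  Cell `pub-balaban`, unit `b2b-balaban-b06-g12` (paper sub-cell B06,
gen 12 — the owner lineage of `…B6`, `…B6RandomWalk`, `…B6Ineq268`, `…B6Ineq283`, `…B6Expansion282`,
`…B6Prop23Chain`, `…B6DomainTerm282`, `…B6DomainMajorant[Sandwich]`; the text was drafted and kernel-checked by gen 11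
as a successor patch and is landed unchanged in its declarations by gen 12).  Source: doi:10.1007/bf01240221, held
`paper:balaban1984-cmp96-propagators-rt-ii`; journal page = PDF page + 222; the quotations below were read from the
page renders `b2b-balaban-ref1/pages/1984-cmp96-propagators-rt-II/1984-cmp96-propagators-rt-II-p013-x2.png` (p. 235)
and `…-p015-x2.png` (p. 237) AS IMAGES (p. 237 re-read by gen 12 against the quotation below).  Kernel twin of the
hand certification GAPS C-adv4-40 (unit b2b-balaban-adv4-g14, hostile second reading of (2.82)–(2.87)); sibling of
`…B6Ineq283` (members 2–5), `…B6Expansion282` (the operators R_{□,□′} read off (2.82) and the kernel dictionary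
`kerOp`/`mulOp` of the pairing (2.69)) and `…B6Prop23Chain` (the assembly (2.85) ⇒ Proposition 2.3, whose hypothesis
`hoff` the last theorem below is shaped for); cell rows GAPS C-b06g12-1, DIVERGENCE D-b06.24; journal claim
LINE4-MEMBER12.

THE PRINTED TEXT.  p. 237 [PDF 15], verbatim: *"… − Σ_{□,□′≠□} (□ − 1)h²_{□′}Q′G′²Q′*h_□C_□h_□
= I − Σ_{□,□′} R_{□,□′}C_{□′}h_{□′} = I − R, (2.82) with an obvious definition of the operators R_{□,□′}. We have to
estimate the norm of R in the space L²(𝔅). For example let us consider the operator R_{□,□′}C_{□′}h_{□′} with □ ≠ □′.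
A kernel of this operator can be estimated as follows
|(□′ − 1)(y) h²_□(y) Σ_{y″∈supp h_{□′}} (L^{j′}η)^d (Q′G′²Q′*)(y, y″) h_{□′}(y″) C_{□′}(y″, y′) h_{□′}(y′)|
≤ O(1)(L^jη)⁴ Σ_{y″∈supp h_{□′}} e^{−½δ₀d(y,y″)} c₁ (L^{j′}η)^{−d−4} e^{−δ₁(L^{j′}η)^{−1}|y″−y′|} ≤ …"* (MEMBERS 1 AND 2
of (2.83); members 2–5, ending *"≤ O(1) e^{−⅛δ₀M} e^{−δ₁d(y,y′)} (L^{j′}η)^{−d}, (2.83) where we have used the fact that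
y ∉ □̃′, and all the properties of the distance d(·, ·)"*, are quoted in full and typed in `…B6Ineq283`); same page:
*"|C_□(y, y′)| ≤ O(1)(L^jη)^{−d−4} e^{−δ₁(L^jη)^{−1}|y−y′|}, y, y′ ∈ 𝔅∩□. (2.81)"*.  p. 235 [PDF 13], verbatim: the
last member of (2.68) *"≤ O(1)(L^jη)⁴(L^{j′}η)^{−d} e^{−¼δ₀d(y,y′)}, (2.68)"* followed by *"Let us notice that the choice
of powers (L^jη)⁴ and (L^{j′}η)^{−d} in the inequality above is purely conventional and we may change it into any other
admissible choice, for example (L^jη)^{−d} and (L^{j′}η)⁴, using the exponential factor e^{−1/4δ₀d(y,y′)} and the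
estimate (2.60)."*, and the pairing *"⟨λ, λ′⟩ = Σ_{j=0}^k Σ_{y∈Λ_j} (L^jη)^d λ(y)λ′(y). (2.69)"*.  p. 238 [PDF 16]:
*"|R(y, y′)| ≤ O(M⁻¹)e^{−δ₁d(y,y′)}(L^{j′}η)^{−d}, y, y′ ∈ 𝔅, y′ ∈ Λ_{j′}, (2.85)"* (quoted in full in `…B6Prop23Chain`).

THE TYPING.  As in `…B6Expansion282` §2–§3: operators on L²(𝔅) are `Module.End ℝ (𝔅 → ℝ)` over a finite site type
(§1: any finite type S; §2: the sites `g.Site` of the abstract multiscale carrier `g : B6.Geometry` of `…B6`, with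
j = `g.scale`, d(·,·) = `g.dist`, L^jη = `g.len`); `mulOp h` is multiplication by h and `kerOp w X` the operator with
kernel X(y, y″) in the pairing (2.69), weights w(y″) = (L^{j″}η)^d ((Tλ)(y) = Σ_{y″} w(y″)X(y, y″)λ(y″)).  The
off-diagonal operator R_{□,□′} = (□′ − 1)h_□²·X·h_{□′} (X = Q′G′²Q′*; the `else` branch of `B6Expansion282.Rpair` with
p □′ = `mulOp p'`, h □ = `mulOp h`, x = `kerOp w X`, h □′ = `mulOp h'`) times C_{□′}h_{□′} (C_{□′} = `kerOp w C`) is the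
kernel operator (`line4_operator_eq`) of
`line4Ker w p' h h' X C (y, y′) = (□′(y) − 1) h_□(y)² (Σ_{y″} w(y″)X(y,y″)h_{□′}(y″)C(y″,y′)) h_{□′}(y′)` = MEMBER 1 of
(2.83) without the absolute value.  The inputs of member 2 are hypotheses of the printed shape with FREE constants:
the (2.68)-type bound of X, weight included, at the rate ½δ₀ that member 2 displays, |w(y″)X(y, y″)| ≤
A_X(L^jη)⁴e^{−½δ₀d(y,y″)} (`hX`; in the admissible choice of powers (L^jη)⁴(L^{j″}η)^{−d} the weight (L^{j″}η)^d
cancels); (2.81) for C_{□′} in the form |C(y″, y′)| ≤ A_C·P(y′)·(L^{j′}η)^{−4}e^{−δ₁ρ(y″)} for y″ ∈ S′ = supp h_{□′},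
C(·, y′) = 0 off S′ (`hC`, `hC0`; P(y′) stands for the positive factor (L^{j′}η)^{−d} and ρ(y″) for the printed straight
contour (L^{j′}η)^{−1}|y″ − y′|, which enters member 3 only through d(y″, y′) ≤ ρ(y″), hypothesis `hρ` — literally the
hypotheses of `B6Expansion282.line2Ker_abs_le_285` and `B6Ineq283.line2_le_line3`); |□′(y) − 1| ≤ 1 (characteristic
function), |h_□| ≤ 1, |h_{□′}| ≤ 1.  Members 2–5 are the carriers `B6Ineq283.line283_2 … line283_5` (common prefactor
O(1)·c₁·(L^{j′}η)^{−d} taken out, here = A_X·A_C·P(y′)).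

WHAT THIS MODULE PROVES (kernel-checked; no `sorry`, no axiom beyond Lean's three; every analytic input a hypothesis
of the printed shape with FREE constants — ABSOLUTE RULE: nothing is cited as a fact):
1. `line4Ker`, `mulOp_sub_one`, `line4_operator_eq`, `line4Ker_sum_eq` — the kernel of the off-diagonal term and the
   operator identity (□′ − 1)·h_□h_□·K_w(X)·h_{□′}·K_w(C)·h_{□′} = K_w(line4Ker) (the y″-integration against the weight
   of (2.69) is the printed Σ_{y″}(L^{j′}η)^d … on supp h_{□′} once C(·, y′) vanishes off S′).
2. `line4Ker_abs_le` — MEMBER 1 ≤ A_X·(A_C P(y′))·`line283_2`, i.e. member 2 with its O(1)·c₁·(L^{j′}η)^{−d} explicit,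
   from `hX`, `hC`, `hC0`, |□′ − 1| ≤ 1, |h_□| ≤ 1, |h_{□′}| ≤ 1 (no geometry beyond L^jη > 0 is used).
3. `line4Ker_abs_le_283` — the whole printed chain MEMBER 1 ≤ A_X A_C P(y′)·c·MEMBER 5 by `B6Ineq283.line2_le_line5`
   under that module's hypotheses ((2.54), d ≥ 0, (2.60) in the metric form `B6Ineq268.LevelSep`, a split
   δ₁ + σδ₀ ≤ ¼δ₀ with (2.61) at α = σ and GENERIC constant c (`B6Lemma21Repaired.Ineq261With`), RM ≥ 0, the
   threshold L⁴ ≤ e^{⅛δ₀RM}, the straight contour, D ≤ d(y, S′) realised at the scale of y′, the gap Mg ≤ D).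
4. `line4Ker_abs_le_285` — the (2.85) reading of the off-diagonal family:
   |line4Ker(y, y′)| ≤ (A_X A_C c L⁴ e^{−⅛δ₀Mg})·e^{−δ₁d(y,y′)}·P(y′), the ε_o·E(y, y′) envelope that
   `B6Prop23Chain.mat_R282_abs_le` takes as `hoff` (after `line4_operator_eq` and `B6Prop23Chain.mat_kerOp`), the
   M-dependence carried by e^{−⅛δ₀Mg} (≤ 8/(e·δ₀Mg): the κ₄, c₄ slots of `B6Prop23Chain.theta_le_inv_M`).
WHAT IT DOES NOT PROVE: the majorant of X = Q′G′²Q′* (hypothesis `hX`: (2.68) prints the rate ¼δ₀ in its last member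
while member 2 of (2.83) carries ½δ₀ — read in C-adv4-40 and in the header of `…B6Ineq283` through the printed remark
on the *"purely conventional"* choice of factors, p. 235; here the rate is a parameter of a hypothesis, not a claim);
(2.81) (hypothesis `hC`; = (2.79) via *"Sect. 5, (5.12)–(5.17) [3]"*, GAPS G-B6-05); the admissibility of the straight
contour (`hρ`), the size of the gap «y ∉ □̃′» (`hgap`; GAPS G-adv4-14) and every other hypothesis of `…B6Ineq283`,
which keep their located status there; the two diagonal families of (2.82) (commutator: `B6Expansion282.line2Ker_abs_le_285`;
change of domain G′(□̃)² − G′²: `…B6DomainMajorantSandwich`); the assembly (2.85) ⇒ Proposition 2.3 (`…B6Prop23Chain`,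
whose discharge of `hdiag`/`hoff` from the three per-term families is the successor node of this lineage).
Value = kernel certificate of one printed inequality sign and of its composition with the certified members 2–5,
NOT summit progress.
-/

namespace Literature.MathematicalPhysics.QuantumFieldTheory.Balaban1983to89.B6Line4Member12

open Literature.MathematicalPhysics.QuantumFieldTheory.Balaban1983to89
open Finset B6Expansion282 B6Ineq283

/-! ## §1. The off-diagonal term is a kernel operator -/

section Kernel

variable {S : Type} [Fintype S]

/-- The kernel of (□′ − 1)h_□² X h_{□′} C_{□′} h_{□′} in the pairing (2.69):
(y, y′) ↦ (□′(y) − 1) h_□(y)² (Σ_{y″} w(y″) X(y,y″) h_{□′}(y″) C(y″,y′)) h_{□′}(y′) — MEMBER 1 of (2.83) without the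
absolute value. [cite: Balaban1984PropagatorsII, (2.83) member 1 p.237] -/
def line4Ker (w p' h h' : S → ℝ) (X C : S → S → ℝ) : S → S → ℝ :=
  fun y y' => (p' y - 1) * h y ^ 2 * (∑ y'', w y'' * X y y'' * h' y'' * C y'' y') * h' y'

omit [Fintype S] in
/-- □′ − 1 is the multiplication operator by □′(y) − 1. [folklore] -/
theorem mulOp_sub_one (p' : S → ℝ) : (mulOp p' - 1 : Module.End ℝ (S → ℝ)) = mulOp (fun y => p' y - 1) := by
  refine LinearMap.ext fun μ => funext fun y => ?_
  simp only [LinearMap.sub_apply, Module.End.one_apply, Pi.sub_apply, mulOp_apply, sub_mul, one_mul]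

/-- **The off-diagonal term of (2.82) is the kernel operator of `line4Ker`**:
(□′ − 1)·h_□h_□·K_w(X)·h_{□′}·K_w(C)·h_{□′} = K_w(line4Ker) — the operator is the `else` branch of `B6Expansion282.Rpair`
(p □′ = `mulOp p'`, h □ = `mulOp h`, x = `kerOp w X`, h □′ = `mulOp h'`) multiplied by C_{□′}h_{□′}.
[cite: Balaban1984PropagatorsII, (2.82) line 4 / (2.83) p.237] -/
theorem line4_operator_eq (w p' h h' : S → ℝ) (X C : S → S → ℝ) :
    (mulOp p' - 1) * (mulOp h * mulOp h) * kerOp w X * mulOp h' * kerOp w C * mulOp h' =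
      kerOp w (line4Ker w p' h h' X C) := by
  rw [mulOp_sub_one, mulOp_mul_mulOp h h, mulOp_mul_mulOp, mulOp_mul_kerOp, kerOp_mul_mulOp, kerOp_mul_kerOp,
    kerOp_mul_mulOp]
  congr 1
  funext y y'
  simp only [compKer, line4Ker, Finset.sum_mul, Finset.mul_sum]
  exact Finset.sum_congr rfl fun y'' _ => by ring

/-- The entry bound reduces to the restricted sum: if C(y″, y′) = 0 off S′ then the y″-sum in `line4Ker` runs over S′.
[folklore] -/
theorem line4Ker_sum_eq (w h' : S → ℝ) (X C : S → S → ℝ) {S' : Finset S} {y' : S}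
    (hC0 : ∀ y'', y'' ∉ S' → C y'' y' = 0) (y : S) :
    (∑ y'', w y'' * X y y'' * h' y'' * C y'' y') = ∑ y'' ∈ S', w y'' * X y y'' * h' y'' * C y'' y' :=
  (Finset.sum_subset (Finset.subset_univ S') fun y'' _ hy'' => by rw [hC0 y'' hy'', mul_zero]).symm

end Kernel

/-! ## §2. MEMBER 1 ≤ MEMBER 2 -/

section Member12

variable {g : B6.Geometry}

/-- **(2.83), MEMBER 1 ≤ MEMBER 2.**  With the (2.68)-type bound of X = Q′G′²Q′* at the rate ½δ₀, weight included,
|w(y″)X(y,y″)| ≤ A_X (L^jη)⁴ e^{−½δ₀d(y,y″)} (y ∈ Λ_j), the bound (2.81) of C_{□′} in the form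
|C(y″,y′)| ≤ A_C·P(y′)·(L^{j′}η)^{−4} e^{−δ₁ρ(y″)} on S′ = supp h_{□′} (P(y′) standing for the positive factor (L^{j′}η)^{−d},
ρ the straight contour) and C(·, y′) = 0 off S′, and |□′ − 1| ≤ 1, |h_□| ≤ 1, |h_{□′}| ≤ 1:
|line4Ker(y, y′)| ≤ A_X · (A_C P(y′)) · (L^jη)⁴(L^{j′}η)^{−4} Σ_{y″∈S′} e^{−½δ₀d(y,y″)} e^{−δ₁ρ(y″)} = A_X A_C P(y′) · `line283_2`.
[cite: Balaban1984PropagatorsII, (2.83) members 1–2 p.237] -/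
theorem line4Ker_abs_le (hL : 1 ≤ g.L) (hη : 0 < g.eta) {δ₀ δ₁ AX AC : ℝ} {P : g.Site → ℝ}
    {w p' h h' : g.Site → ℝ} {X C : g.Site → g.Site → ℝ} {S' : Finset g.Site} {ρ : g.Site → ℝ} {y y' : g.Site}
    (hX : ∀ y'', |w y'' * X y y''| ≤ AX * g.len y ^ 4 * Real.exp (-(1 / 2 * δ₀ * g.dist y y'')))
    (hC : ∀ y'' ∈ S', |C y'' y'| ≤ AC * P y' / g.len y' ^ 4 * Real.exp (-(δ₁ * ρ y'')))
    (hC0 : ∀ y'', y'' ∉ S' → C y'' y' = 0)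
    (hp1 : |p' y - 1| ≤ 1) (hh1 : |h y| ≤ 1) (hh'1 : ∀ y'', |h' y''| ≤ 1) :
    |line4Ker w p' h h' X C y y'| ≤ AX * (AC * P y') * line283_2 g δ₀ δ₁ S' ρ y y' := by
  have hL0 : 0 < g.L := zero_lt_one.trans_le hL
  -- the y″-sum: restrict to S′, bound termwise by (2.68)-type × |h′| ≤ 1 × (2.81)
  have hsum : |∑ y'', w y'' * X y y'' * h' y'' * C y'' y'| ≤
      AX * g.len y ^ 4 * (AC * P y' / g.len y' ^ 4) *
        ∑ y'' ∈ S', Real.exp (-(1 / 2 * δ₀ * g.dist y y'')) * Real.exp (-(δ₁ * ρ y'')) := by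
    rw [line4Ker_sum_eq w h' X C hC0 y, Finset.mul_sum]
    refine (Finset.abs_sum_le_sum_abs _ _).trans (Finset.sum_le_sum fun y'' hy'' => ?_)
    have e1 : w y'' * X y y'' * h' y'' * C y'' y' = (w y'' * X y y'') * h' y'' * C y'' y' := by ring
    rw [e1, abs_mul, abs_mul]
    have hA := hX y''
    have hB := hC y'' hy''
    calc |w y'' * X y y''| * |h' y''| * |C y'' y'|
        ≤ (AX * g.len y ^ 4 * Real.exp (-(1 / 2 * δ₀ * g.dist y y''))) * 1 *
            (AC * P y' / g.len y' ^ 4 * Real.exp (-(δ₁ * ρ y''))) := by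
          apply mul_le_mul (mul_le_mul hA (hh'1 y'') (abs_nonneg _) ((abs_nonneg _).trans hA)) hB (abs_nonneg _)
          exact mul_nonneg ((abs_nonneg _).trans hA) zero_le_one
      _ = AX * g.len y ^ 4 * (AC * P y' / g.len y' ^ 4) *
            (Real.exp (-(1 / 2 * δ₀ * g.dist y y'')) * Real.exp (-(δ₁ * ρ y''))) := by ring
  -- the row prefactor |□′ − 1| h_□² ≤ 1 and the column factor |h_{□′}(y′)| ≤ 1
  have hpre : |p' y - 1| * |h y| ^ 2 ≤ 1 := by
    calc |p' y - 1| * |h y| ^ 2 ≤ 1 * 1 :=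
          mul_le_mul hp1 (pow_le_one₀ (abs_nonneg _) hh1) (pow_nonneg (abs_nonneg _) 2) zero_le_one
      _ = 1 := one_mul 1
  have hS0 : 0 ≤ |∑ y'', w y'' * X y y'' * h' y'' * C y'' y'| := abs_nonneg _
  calc |line4Ker w p' h h' X C y y'|
      = |p' y - 1| * |h y| ^ 2 * |∑ y'', w y'' * X y y'' * h' y'' * C y'' y'| * |h' y'| := by
        unfold line4Ker; rw [abs_mul, abs_mul, abs_mul, abs_pow]
    _ ≤ 1 * |∑ y'', w y'' * X y y'' * h' y'' * C y'' y'| * 1 :=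
        mul_le_mul (mul_le_mul_of_nonneg_right hpre hS0) (hh'1 y') (abs_nonneg _) (mul_nonneg zero_le_one hS0)
    _ = |∑ y'', w y'' * X y y'' * h' y'' * C y'' y'| := by ring
    _ ≤ AX * g.len y ^ 4 * (AC * P y' / g.len y' ^ 4) *
          ∑ y'' ∈ S', Real.exp (-(1 / 2 * δ₀ * g.dist y y'')) * Real.exp (-(δ₁ * ρ y'')) := hsum
    _ = AX * (AC * P y') * (g.len y ^ 4 / g.len y' ^ 4 *
          ∑ y'' ∈ S', Real.exp (-(1 / 2 * δ₀ * g.dist y y'')) * Real.exp (-(δ₁ * ρ y''))) := by ring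
    _ = AX * (AC * P y') * line283_2 g δ₀ δ₁ S' ρ y y' := by
        simp only [line283_2, ratio4_eq_len hL0.ne' hη.ne']

/-- **THE WHOLE PRINTED CHAIN FOR THE OFF-DIAGONAL TERM: MEMBER 1 ≤ A_X A_C P(y′) · c · MEMBER 5**, composing
`line4Ker_abs_le` with `B6Ineq283.line2_le_line5` (members 2 ≤ c·3 ≤ c·4 ≤ c·5 under (2.54), (2.60) in metric form,
(2.61) at α = σ with δ₁ + σδ₀ ≤ ¼δ₀ and generic constant c, the straight contour on supp h_{□′}, D = d(y, supp h_{□′})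
realised at the scale of y′, the gap Mg ≤ D («y ∉ □̃′») and the threshold L⁴ ≤ e^{⅛δ₀RM}).
[cite: Balaban1984PropagatorsII, (2.83) p.237] -/
theorem line4Ker_abs_le_283 (htri : B6RandomWalk.Triangle254 g) (hd : ∀ a b : g.Site, 0 ≤ g.dist a b)
    (hsep : B6Ineq268.LevelSep g) (hL : 1 ≤ g.L) (hη : 0 < g.eta)
    {δ₀ δ₁ σ c D Mg AX AC : ℝ} (hδ₀ : 0 ≤ δ₀) (hδ₁ : 0 ≤ δ₁) (hsplit : δ₁ + σ * δ₀ ≤ δ₀ / 4)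
    (h261 : B6Lemma21Repaired.Ineq261With c g δ₀ σ) (hRM : 0 ≤ g.R * g.M)
    (hthr : g.L ^ 4 ≤ Real.exp (1 / 8 * δ₀ * g.R * g.M)) (hAX : 0 ≤ AX) (hAC : 0 ≤ AC)
    {P : g.Site → ℝ} (hP : ∀ z, 0 ≤ P z)
    {w p' h h' : g.Site → ℝ} {X C : g.Site → g.Site → ℝ} {S' : Finset g.Site} {ρ : g.Site → ℝ}
    {y y' y₀ : g.Site}
    (hX : ∀ y'', |w y'' * X y y''| ≤ AX * g.len y ^ 4 * Real.exp (-(1 / 2 * δ₀ * g.dist y y'')))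
    (hC : ∀ y'' ∈ S', |C y'' y'| ≤ AC * P y' / g.len y' ^ 4 * Real.exp (-(δ₁ * ρ y'')))
    (hC0 : ∀ y'', y'' ∉ S' → C y'' y' = 0)
    (hρ : ∀ y'' ∈ S', g.dist y'' y' ≤ ρ y'') (hD : ∀ y'' ∈ S', D ≤ g.dist y y'')
    (hsc : g.scale y₀ = g.scale y') (hy₀ : g.dist y y₀ ≤ D) (hgap : Mg ≤ D)
    (hp1 : |p' y - 1| ≤ 1) (hh1 : |h y| ≤ 1) (hh'1 : ∀ y'', |h' y''| ≤ 1) :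
    |line4Ker w p' h h' X C y y'| ≤ AX * (AC * P y') * (c * line283_5 g δ₀ δ₁ Mg y y') :=
  (line4Ker_abs_le hL hη hX hC hC0 hp1 hh1 hh'1).trans
    (mul_le_mul_of_nonneg_left
      (line2_le_line5 htri hd hsep hL hδ₀ hδ₁ hsplit h261 hRM hthr hρ hD hsc hy₀ hgap)
      (mul_nonneg hAX (mul_nonneg hAC (hP y'))))

/-- **THE (2.85) READING OF THE OFF-DIAGONAL FAMILY**: in the shape *"|R(y, y′)| ≤ O(M⁻¹)e^{−δ₁d(y,y′)}(L^{j′}η)^{−d}"*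
with the M-dependence carried by e^{−⅛δ₀Mg} (Mg = the gap «y ∉ □̃′», ∝ M):
|line4Ker(y, y′)| ≤ (A_X A_C c L⁴ e^{−⅛δ₀Mg}) · e^{−δ₁d(y,y′)} · P(y′) — the ε_o·E(y,y′) envelope that
`B6Prop23Chain.mat_R282_abs_le` takes as `hoff` (after `line4_operator_eq` + `B6Prop23Chain.mat_kerOp`), with
e^{−⅛δ₀Mg} ≤ 8/(e δ₀ Mg) feeding the κ₄, c₄ slots of `B6Prop23Chain.theta_le_inv_M`.
[cite: Balaban1984PropagatorsII, (2.83)–(2.85) pp.237–238] -/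
theorem line4Ker_abs_le_285 (htri : B6RandomWalk.Triangle254 g) (hd : ∀ a b : g.Site, 0 ≤ g.dist a b)
    (hsep : B6Ineq268.LevelSep g) (hL : 1 ≤ g.L) (hη : 0 < g.eta)
    {δ₀ δ₁ σ c D Mg AX AC : ℝ} (hδ₀ : 0 ≤ δ₀) (hδ₁ : 0 ≤ δ₁) (hsplit : δ₁ + σ * δ₀ ≤ δ₀ / 4)
    (h261 : B6Lemma21Repaired.Ineq261With c g δ₀ σ) (hRM : 0 ≤ g.R * g.M)
    (hthr : g.L ^ 4 ≤ Real.exp (1 / 8 * δ₀ * g.R * g.M)) (hAX : 0 ≤ AX) (hAC : 0 ≤ AC)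
    {P : g.Site → ℝ} (hP : ∀ z, 0 ≤ P z)
    {w p' h h' : g.Site → ℝ} {X C : g.Site → g.Site → ℝ} {S' : Finset g.Site} {ρ : g.Site → ℝ}
    {y y' y₀ : g.Site}
    (hX : ∀ y'', |w y'' * X y y''| ≤ AX * g.len y ^ 4 * Real.exp (-(1 / 2 * δ₀ * g.dist y y'')))
    (hC : ∀ y'' ∈ S', |C y'' y'| ≤ AC * P y' / g.len y' ^ 4 * Real.exp (-(δ₁ * ρ y'')))
    (hC0 : ∀ y'', y'' ∉ S' → C y'' y' = 0)
    (hρ : ∀ y'' ∈ S', g.dist y'' y' ≤ ρ y'') (hD : ∀ y'' ∈ S', D ≤ g.dist y y'')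
    (hsc : g.scale y₀ = g.scale y') (hy₀ : g.dist y y₀ ≤ D) (hgap : Mg ≤ D)
    (hp1 : |p' y - 1| ≤ 1) (hh1 : |h y| ≤ 1) (hh'1 : ∀ y'', |h' y''| ≤ 1) :
    |line4Ker w p' h h' X C y y'| ≤
      (AX * AC * c * g.L ^ 4 * Real.exp (-(1 / 8 * δ₀ * Mg))) * Real.exp (-(δ₁ * g.dist y y')) * P y' := by
  refine (line4Ker_abs_le_283 htri hd hsep hL hη hδ₀ hδ₁ hsplit h261 hRM hthr hAX hAC hP hX hC hC0 hρ hD hsc hy₀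
    hgap hp1 hh1 hh'1).trans (le_of_eq ?_)
  simp only [line283_5]
  ring

end Member12

end Literature.MathematicalPhysics.QuantumFieldTheory.Balaban1983to89.B6Line4Member12
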